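import Summits.RiemannHypothesis.RiemannHypothesis.Theorems.PfPersistenceDilatingLandauWeightedZeroSum
import Summits.RiemannHypothesis.RiemannHypothesis.Theorems.PfPersistenceDilatingLandauWeightedDictionary
import Literature.Barriers.RiemannHypothesis.LittlewoodOscillationProofs
import Literature.NumberTheory.LFunctions.VonKochTheorem
import HarnessLib

/-!
# LANDAU for the weighted dilating statistic `S(x) = Σ_{n ≤ x} Λ(n)/√n` — VII: Littlewood transfer

Cell `pub-rhpf` (mechanism/rigidity campaign; **no RH claims**), CAND SEAT 7 gen 8, CASE-DAG v6 §6
kernel target LANDAU, weighted statistic `S`, last file: the `O(1)` row of the `S`-face is closed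
UNCONDITIONALLY.

* Under RH, file VI gives `S(x) − 2√x = (ψ(x) − x)/√x + O(1)`, and Littlewood's theorem
  (tree barrier `Literature.Barriers.RiemannHypothesis.LittlewoodOscillation_holds`,
  `ψ(x) − x = Ω±(√x log log log x)`, unconditional) transfers to
  **`S(x) − 2√x = Ω±(log log log x)`** (`isOmegaPM_wpsiErr_of_riemannHypothesis`).
* Off RH, file III gives `S(x) − 2√x = Ω±(x^δ)` for some `δ > 0`
  (`exists_wpsiErr_oscillation_of_not_riemannHypothesis`).
* Hence, with NO hypothesis: `S(x) − 2√x` is unbounded above AND below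
  (`frequently_lt_wpsiErr`, `frequently_wpsiErr_lt`), i.e. **every one-sided `O(1)` reader of `S`
  — `S(x) ≤ 2√x + A` or `S(x) ≥ 2√x − A` for all large `x` — is FALSE for `ζ`**
  (`not_eventually_wpsi_le`, `not_eventually_le_wpsi`), exactly as the `O(√x)` readers of `ψ` are
  (`PfPersistenceDilatingLandau`, §3). Together with files III/V (RH ⟺ each one-sided `x^ε` reader,
  every `ε > 0`) this completes the reader table of the `S`-face: RH-strength at every sound scale,
  unsound at the constant scale; never an RH-free certificate.
* §14, the sharp two-sided form: **RH ⟺ `S(x) − 2√x = O(log² x)`**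
  (`riemannHypothesis_iff_wpsiErr_isBigO_log_sq`; ⟹ by file VI and von Koch, tree
  `vonKoch_chebyshevPsi_of_riemannHypothesis_holds`; ⟸ by file III).

Sorry-free; `RiemannHypothesis` appears only as an explicit hypothesis or inside a case split
(`by_cases`) whose two branches are both proved.

References: [MontgomeryVaughan2007] H. L. Montgomery, R. C. Vaughan, *Multiplicative Number Theory I*,
CUP 2007, Thm. 13.1, Thm. 15.3, Thm. 15.11 ((15.22)); [Littlewood1914] J. E. Littlewood, *Sur la
distribution des nombres premiers*, C. R. Acad. Sci. Paris 158 (1914) (as cited in MV §15.3).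
-/

noncomputable section

-- the sub-problem path RiemannHypothesis/RiemannHypothesis duplicates a namespace (D-0017)
set_option linter.dupNamespace false

open Filter Topology Set Asymptotics

namespace Summit.RiemannHypothesis.RiemannHypothesis.Theorems.PfPersistenceDilatingLandauWeightedLittlewood

open Literature.NumberTheory.LFunctions
open Literature.Barriers.RiemannHypothesis
open Summit.RiemannHypothesis.RiemannHypothesis.Theorems.PfPersistenceDilatingLandauWeightedMellin
open Summit.RiemannHypothesis.RiemannHypothesis.Theorems.PfPersistenceDilatingLandauWeightedZeroSum
open Summit.RiemannHypothesis.RiemannHypothesis.Theorems.PfPersistenceDilatingLandauWeightedDictionary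

/-! ## §12 Under RH: `S(x) − 2√x = Ω±(log log log x)` -/

/-- **RH ⇒ `S(x) − 2√x = Ω₊(log log log x)`** (Littlewood's `Ω₊(√x log log log x)` for `ψ`, divided by
`√x`, survives the `O(1)` transfer error of file VI). [cite: MontgomeryVaughan2007, Thm. 15.11 (15.22); Thm. 13.1] -/
theorem isOmegaPlus_wpsiErr_of_riemannHypothesis (hRH : RiemannHypothesis) :
    IsOmegaPlus wpsiErr logloglog := by
  obtain ⟨c, hc, hfreq⟩ := LittlewoodOscillation_holds.1.1
  obtain ⟨K, hK⟩ := exists_abs_wpsiErr_sub_le_of_riemannHypothesis hRH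
  refine ⟨c / 2, by positivity, ?_⟩
  have hev : ∀ᶠ x in atTop, K ≤ c / 2 * logloglog x :=
    (tendsto_logloglog_atTop.const_mul_atTop (by positivity : 0 < c / 2)).eventually_ge_atTop K
  refine (hfreq.and_eventually (hev.and (eventually_ge_atTop 1))).mono fun x hx ↦ ?_
  obtain ⟨hle, hK', hx1⟩ := hx
  have hx0 : 0 < x := by linarith
  have hxr : 0 < x ^ (1 / 2 : ℝ) := Real.rpow_pos_of_pos hx0 _
  have hle' : c * (x ^ (1 / 2 : ℝ) * logloglog x) ≤ Chebyshev.psi x - x := hle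
  have h1 : c * logloglog x ≤ x ^ (-(1 / 2 : ℝ)) * (Chebyshev.psi x - x) := by
    rw [Real.rpow_neg hx0.le, le_inv_mul_iff₀ hxr]
    linarith
  have h2 := hK x hx1
  rw [abs_le] at h2
  linarith [h2.1]

/-- **RH ⇒ `S(x) − 2√x = Ω₋(log log log x)`.** [cite: MontgomeryVaughan2007, Thm. 15.11 (15.22); Thm. 13.1] -/
theorem isOmegaMinus_wpsiErr_of_riemannHypothesis (hRH : RiemannHypothesis) :
    IsOmegaMinus wpsiErr logloglog := by
  obtain ⟨c, hc, hfreq⟩ := LittlewoodOscillation_holds.1.2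
  obtain ⟨K, hK⟩ := exists_abs_wpsiErr_sub_le_of_riemannHypothesis hRH
  refine ⟨c / 2, by positivity, ?_⟩
  have hev : ∀ᶠ x in atTop, K ≤ c / 2 * logloglog x :=
    (tendsto_logloglog_atTop.const_mul_atTop (by positivity : 0 < c / 2)).eventually_ge_atTop K
  refine (hfreq.and_eventually (hev.and (eventually_ge_atTop 1))).mono fun x hx ↦ ?_
  obtain ⟨hle, hK', hx1⟩ := hx
  have hx0 : 0 < x := by linarith
  have hxr : 0 < x ^ (1 / 2 : ℝ) := Real.rpow_pos_of_pos hx0 _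
  have hle' : Chebyshev.psi x - x ≤ -(c * (x ^ (1 / 2 : ℝ) * logloglog x)) := hle
  have h1 : x ^ (-(1 / 2 : ℝ)) * (Chebyshev.psi x - x) ≤ -(c * logloglog x) := by
    rw [Real.rpow_neg hx0.le, inv_mul_le_iff₀ hxr]
    linarith
  have h2 := hK x hx1
  rw [abs_le] at h2
  linarith [h2.2]

/-- **RH ⇒ `S(x) − 2√x = Ω±(log log log x)`.** [cite: MontgomeryVaughan2007, Thm. 15.11 (15.22); Thm. 13.1] -/
theorem isOmegaPM_wpsiErr_of_riemannHypothesis (hRH : RiemannHypothesis) :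
    IsOmegaPM wpsiErr logloglog :=
  ⟨isOmegaPlus_wpsiErr_of_riemannHypothesis hRH, isOmegaMinus_wpsiErr_of_riemannHypothesis hRH⟩

/-! ## §13 Unconditionally: `S(x) − 2√x` is unbounded above and below -/

/-- **`S(x) − 2√x > A` for arbitrarily large `x`, for EVERY real `A`** (unconditional: under RH by
§12, off RH by the `Ω₊(x^δ)` of file III). [cite: MontgomeryVaughan2007, Thm. 15.11, Thm. 15.3] -/
theorem frequently_lt_wpsiErr (A : ℝ) : ∃ᶠ x in atTop, A < wpsiErr x := by
  by_cases hRH : RiemannHypothesis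
  · obtain ⟨c, hc, hfreq⟩ := isOmegaPlus_wpsiErr_of_riemannHypothesis hRH
    have hev : ∀ᶠ x in atTop, A < c * logloglog x :=
      (tendsto_logloglog_atTop.const_mul_atTop hc).eventually_gt_atTop A
    exact (hfreq.and_eventually hev).mono fun x hx ↦ hx.2.trans_le hx.1
  · obtain ⟨δ, c, hδ, hc, hplus, -⟩ := exists_wpsiErr_oscillation_of_not_riemannHypothesis hRH
    have hev : ∀ᶠ x in atTop, A < c * x ^ δ :=
      ((tendsto_rpow_atTop hδ).const_mul_atTop hc).eventually_gt_atTop A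
    exact (hplus.and_eventually hev).mono fun x hx ↦ hx.2.trans_le hx.1

/-- **`S(x) − 2√x < A` for arbitrarily large `x`, for EVERY real `A`** (unconditional).
[cite: MontgomeryVaughan2007, Thm. 15.11, Thm. 15.3] -/
theorem frequently_wpsiErr_lt (A : ℝ) : ∃ᶠ x in atTop, wpsiErr x < A := by
  by_cases hRH : RiemannHypothesis
  · obtain ⟨c, hc, hfreq⟩ := isOmegaMinus_wpsiErr_of_riemannHypothesis hRH
    have hev : ∀ᶠ x in atTop, -A < c * logloglog x :=
      (tendsto_logloglog_atTop.const_mul_atTop hc).eventually_gt_atTop (-A)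
    exact (hfreq.and_eventually hev).mono fun x hx ↦ by linarith [hx.1, hx.2]
  · obtain ⟨δ, c, hδ, hc, -, hminus⟩ := exists_wpsiErr_oscillation_of_not_riemannHypothesis hRH
    have hev : ∀ᶠ x in atTop, -A < c * x ^ δ :=
      ((tendsto_rpow_atTop hδ).const_mul_atTop hc).eventually_gt_atTop (-A)
    exact (hminus.and_eventually hev).mono fun x hx ↦ by linarith [hx.1, hx.2]

/-- **The upper `O(1)` reader of `S` is FALSE for `ζ`:** for no real `A` does `S(x) ≤ 2√x + A` hold for
all large `x` (unconditional). [cite: MontgomeryVaughan2007, Thm. 15.11, Thm. 15.3] -/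
theorem not_eventually_wpsi_le (A : ℝ) : ¬ ∀ᶠ x in atTop, wpsi x ≤ 2 * x ^ (1 / 2 : ℝ) + A := by
  intro h
  obtain ⟨x, hx1, hx2⟩ := ((frequently_lt_wpsiErr A).and_eventually h).exists
  rw [wpsiErr] at hx1
  linarith

/-- **The lower `O(1)` reader of `S` is FALSE for `ζ`:** for no real `A` does `S(x) ≥ 2√x − A` hold for
all large `x` (unconditional). [cite: MontgomeryVaughan2007, Thm. 15.11, Thm. 15.3] -/
theorem not_eventually_le_wpsi (A : ℝ) : ¬ ∀ᶠ x in atTop, 2 * x ^ (1 / 2 : ℝ) - A ≤ wpsi x := by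
  intro h
  obtain ⟨x, hx1, hx2⟩ := ((frequently_wpsiErr_lt (-A)).and_eventually h).exists
  rw [wpsiErr] at hx1
  linarith

/-- **The `S`-face reader words at the constant scale** (unconditional): a one-sided `O(1)` bound on
`S(x) − 2√x` would imply RH (file III) — and is false (this file); both signs. So the implications
`riemannHypothesis_of_wpsi_le` / `riemannHypothesis_of_le_wpsi` are vacuous for `ζ`, exactly as
`ψ(x) − x = O(√x) ⇒ RH` is (Littlewood barrier, Route A). [cite: MontgomeryVaughan2007, Thm. 15.11, Thm. 15.3, Thm. 13.1] -/
theorem wpsi_bdd_readers (A : ℝ) :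
    (¬ ∀ᶠ x in atTop, wpsi x ≤ 2 * x ^ (1 / 2 : ℝ) + A) ∧
      (¬ ∀ᶠ x in atTop, 2 * x ^ (1 / 2 : ℝ) - A ≤ wpsi x) ∧
      ((∀ᶠ x in atTop, wpsi x ≤ 2 * x ^ (1 / 2 : ℝ) + A) → RiemannHypothesis) ∧
      ((∀ᶠ x in atTop, 2 * x ^ (1 / 2 : ℝ) - A ≤ wpsi x) → RiemannHypothesis) :=
  ⟨not_eventually_wpsi_le A, not_eventually_le_wpsi A, riemannHypothesis_of_wpsi_le,
    riemannHypothesis_of_le_wpsi⟩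

/-! ## §14 The sharp form: RH ⟺ `S(x) − 2√x = O(log² x)` -/

/-- **RH ⇒ `S(x) − 2√x = O(log² x)`** (file VI transfer + von Koch `ψ(x) − x = O(√x log² x)`).
[cite: MontgomeryVaughan2007, Thm. 13.1; Koch1901] -/
theorem wpsiErr_isBigO_log_sq_of_riemannHypothesis (hRH : RiemannHypothesis) :
    wpsiErr =O[atTop] fun x ↦ Real.log x ^ 2 := by
  obtain ⟨K, hK⟩ := exists_abs_wpsiErr_sub_le_of_riemannHypothesis hRH
  obtain ⟨C, hC0, hC⟩ := (vonKoch_chebyshevPsi_of_riemannHypothesis_holds hRH).exists_nonneg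
  have hK0 : 0 ≤ K := (abs_nonneg _).trans (hK 1 le_rfl)
  refine IsBigO.of_bound (C + K) ?_
  filter_upwards [hC.bound, eventually_ge_atTop (Real.exp 1)] with x hx hxe
  have hx0 : 0 < x := (Real.exp_pos 1).trans_le hxe
  have hx1 : 1 ≤ x := le_trans (by linarith [Real.add_one_le_exp (1 : ℝ)]) hxe
  have hxr : 0 < x ^ (1 / 2 : ℝ) := Real.rpow_pos_of_pos hx0 _
  have hlog1 : 1 ≤ Real.log x := by
    rw [Real.le_log_iff_exp_le hx0]; exact hxe
  have hL : 1 ≤ ‖Real.log x ^ 2‖ := by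
    rw [Real.norm_eq_abs, abs_of_nonneg (sq_nonneg _)]; nlinarith
  have h1 : |x ^ (-(1 / 2 : ℝ)) * (Chebyshev.psi x - x)| ≤ C * ‖Real.log x ^ 2‖ := by
    have hx' : ‖Chebyshev.psi x - x‖ ≤ C * ‖x ^ (1 / 2 : ℝ) * Real.log x ^ 2‖ := hx
    rw [norm_mul, Real.norm_eq_abs (x ^ (1 / 2 : ℝ)), abs_of_pos hxr, Real.norm_eq_abs] at hx'
    rw [abs_mul, abs_of_pos (Real.rpow_pos_of_pos hx0 _), Real.rpow_neg hx0.le,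
      inv_mul_le_iff₀ hxr, Real.norm_eq_abs]
    calc |Chebyshev.psi x - x| ≤ C * (x ^ (1 / 2 : ℝ) * |Real.log x ^ 2|) := hx'
      _ = x ^ (1 / 2 : ℝ) * (C * |Real.log x ^ 2|) := by ring
  have h2 := hK x hx1
  rw [Real.norm_eq_abs]
  calc |wpsiErr x| ≤ |wpsiErr x - x ^ (-(1 / 2 : ℝ)) * (Chebyshev.psi x - x)| +
        |x ^ (-(1 / 2 : ℝ)) * (Chebyshev.psi x - x)| := by
          have := abs_add_le (wpsiErr x - x ^ (-(1 / 2 : ℝ)) * (Chebyshev.psi x - x))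
            (x ^ (-(1 / 2 : ℝ)) * (Chebyshev.psi x - x))
          rwa [sub_add_cancel] at this
    _ ≤ K * ‖Real.log x ^ 2‖ + C * ‖Real.log x ^ 2‖ := by
          refine add_le_add ?_ h1
          calc _ ≤ K := h2
            _ = K * 1 := (mul_one K).symm
            _ ≤ K * ‖Real.log x ^ 2‖ := mul_le_mul_of_nonneg_left hL hK0
    _ = (C + K) * ‖Real.log x ^ 2‖ := by ring

/-- **`S(x) − 2√x = O(log² x)` ⇒ RH** (indeed any `O(x^ε)`-∀ε bound does, file III).
[cite: MontgomeryVaughan2007, Thm. 15.3 (shifted)] -/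
theorem riemannHypothesis_of_wpsiErr_isBigO_log_sq (h : wpsiErr =O[atTop] fun x ↦ Real.log x ^ 2) :
    RiemannHypothesis := by
  refine quasiRiemannHypothesis_one_half_iff_holds.1 fun s hs hσs _h1 ↦ ?_
  obtain ⟨C, hC0, hC⟩ := h.exists_nonneg
  set τ : ℝ := (s.re - 1 / 2) / 2 with hτ
  have hτ0 : 0 < τ := by rw [hτ]; linarith
  have hlog : (fun x : ℝ ↦ Real.log x ^ 2) =o[atTop] fun x ↦ x ^ τ := by
    simpa only [Real.rpow_two] using isLittleO_log_rpow_rpow_atTop (2 : ℝ) hτ0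
  have hev : ∀ᶠ x in atTop, 1 * wpsiErr x ≤ C * x ^ τ := by
    filter_upwards [hC.bound, hlog.bound one_pos, eventually_gt_atTop 0] with x h1 h2 hx0
    rw [one_mul, Real.norm_eq_abs (x ^ τ), abs_of_pos (Real.rpow_pos_of_pos hx0 _)] at h2
    calc 1 * wpsiErr x ≤ ‖wpsiErr x‖ := by rw [one_mul]; exact Real.le_norm_self _
      _ ≤ C * ‖Real.log x ^ 2‖ := h1
      _ ≤ C * x ^ τ := mul_le_mul_of_nonneg_left h2 hC0
  have := re_le_of_wpsi_oneSided (η := 1) (Or.inl rfl) hτ0.le hev hs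
  rw [hτ] at this
  linarith

/-- **RH ⟺ `S(x) − 2√x = O(log² x)`** — the weighted analogue of von Koch's
`RH ⟺ ψ(x) − x = O(√x log² x)`. [cite: MontgomeryVaughan2007, Thm. 13.1, Thm. 15.3] -/
theorem riemannHypothesis_iff_wpsiErr_isBigO_log_sq :
    RiemannHypothesis ↔ wpsiErr =O[atTop] fun x ↦ Real.log x ^ 2 :=
  ⟨wpsiErr_isBigO_log_sq_of_riemannHypothesis, riemannHypothesis_of_wpsiErr_isBigO_log_sq⟩

end Summit.RiemannHypothesis.RiemannHypothesis.Theorems.PfPersistenceDilatingLandauWeightedLittlewood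

end
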